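import Summits.KontsevichZagierPeriods.KontsevichZagierPeriods.Theorems.TerasomaMultiplicationBetaCancellationWeightDescent
import Summits.KontsevichZagierPeriods.KontsevichZagierPeriods.Theorems.LiouvilleUnfoldingAyoubPiCancellationStubStripWeight
import Summits.KontsevichZagierPeriods.KontsevichZagierPeriods.Theorems.LiouvilleUnfoldingAyoubPiCancellationStubStripConst

/-!
# Crux stmt-KontsevichZagierPeriods-0540 (`LiouvilleUnfolding.AyoubPiCancellation` ≡ `KZ.PiCancellation`),
# line `Sketch` (idea `moving-segment-wronskian`): stub `stub_stripWeightDescent`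

Support file (`--supports` stmt-KontsevichZagierPeriods-0540) of the line skeleton, registered stub
`stub_stripWeightDescent` (S, glue): **item 0540 ⟺ STRIP-WEIGHT REDUCTION**, the maximal certificate
class of the line.

Fix an interior strip `-1 < a < b < 1` (`a b` rational) and its STRIP WEIGHT of the first disc
coordinate `w_{a,b}(t) = 𝟙_{(a,b)}(t) / (2√(1 − t²))`. Item 0540 (`AyoubPiCancellation`) holds iff
every relation among disc multiples `[π]·c = lift (of ∘ P) c ∈ relations` (pinned disc family `P`)
lies in the closure of additivity (rules (1)), Newton–Leibniz over bases of dimension `≥ 1`, and the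
rule-(2) substitutions `Φ` PRESERVING `w_{a,b}(z₀)`: `w_{a,b}(Φ x 0) = w_{a,b}(x 0)` on `r.domain`.
This `w_{a,b}`-preserving class contains the slab-fibred class
(`Theorems/…SlabFibredDescent.lean`), the strip-respecting class (`Theorems/…StripDescent.lean`) and
the fibred class.

Proof. This is the literal instance of the master equivalence
`BetaCancellationLine.ayoubPiCancellation_iff_weightReduction`
(`Theorems/TerasomaMultiplicationBetaCancellationWeightDescent.lean`) at the weight `w_{a,b}`: the
weight is admissible by `stub_stripWeight` (semialgebraic on `ℝ¹`, bounded), and the weighted disc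
`[D, w_{a,b}]` of `stub_stripConst` finishes, being worth the non-zero rational constant `b − a`
against every factor (`BetaCancellationLine.mem_relations_of_of_mul_mem_of_forall_prod_equivalent`).
No definitions; sorry-free; axioms ⊆ {propext, Classical.choice, Quot.sound}.

References: M. Kontsevich, D. Zagier, *Periods* (2001), §1.2 (rules (1)–(3)), §4.1; J. Ayoub,
*Une version relative de la conjecture des périodes de Kontsevich–Zagier*, Ann. of Math. 181
(2015), §1.
-/

noncomputable section

-- `Summit.KontsevichZagierPeriods.KontsevichZagierPeriods.…` is the tree's mandated layout (single-conjunct summit).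
set_option linter.dupNamespace false

namespace Summit.KontsevichZagierPeriods.KontsevichZagierPeriods.AyoubPiCancellationLine

open Set
open Literature.NumberTheory.Transcendental
open Literature.NumberTheory.Transcendental.KZ
open Summit.KontsevichZagierPeriods.KontsevichZagierPeriods.BetaCancellationLine
  (ayoubPiCancellation_iff_weightReduction mem_relations_of_of_mul_mem_of_forall_prod_equivalent)

-- adapted from Summits/KontsevichZagierPeriods/KontsevichZagierPeriods/Theorems/LiouvilleUnfoldingAyoubPiCancellationStripDescent.lean
-- (`stub_stripDescent`: same admissibility / finishing data, master iff instead of `weightDescent`)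

/-- **STUB `stub_stripWeightDescent`** (S, glue) of the line `Sketch`: **item 0540 ⟺ strip-weight
reduction.** For an interior strip `-1 < a < b < 1` (`a b` rational), `AyoubPiCancellation` holds iff
every relation `[π]·c ∈ relations` among disc multiples (pinned disc family `P`) lies in the closure
of additivity, Newton–Leibniz over bases of dimension `≥ 1`, and rule-(2) substitutions preserving
the strip weight `w_{a,b}(z₀) = 𝟙_{(a,b)}(z₀) / (2√(1 − z₀²))` of the first coordinate. Instance of
`BetaCancellationLine.ayoubPiCancellation_iff_weightReduction` with the admissible weight of
`stub_stripWeight` and the finishing weighted disc `[D, w_{a,b}] ∼ b − a ≠ 0` of `stub_stripConst`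
(`BetaCancellationLine.mem_relations_of_of_mul_mem_of_forall_prod_equivalent`). [folklore] -/
theorem stub_stripWeightDescent : ∀ (a b : ℚ), -1 < a → a < b → b < 1 →
    (Summit.KontsevichZagierPeriods.KontsevichZagierPeriods.Theses.AyoubSpecialisation.AyoubPiCancellation ↔
    ∀ (P : ∀ n : ℕ, IntegralRep n → IntegralRep (n + 2)),
      (∀ (n : ℕ) (r : IntegralRep n),
        (P n r).domain = {z : Fin (n + 2) → ℝ | z 0 ^ 2 + z 1 ^ 2 ≤ 1 ∧
          (fun i : Fin n => z i.succ.succ) ∈ r.domain} ∧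
        (P n r).integrand = fun z => r.integrand (fun i : Fin n => z i.succ.succ)) →
      ∀ c : FormalRep,
        FreeAbelianGroup.lift (fun s : (Σ n, IntegralRep n) => of (P s.1 s.2)) c ∈ relations →
        FreeAbelianGroup.lift (fun s : (Σ n, IntegralRep n) => of (P s.1 s.2)) c ∈
          AddSubgroup.closure (domainAddRel ∪ integrandAddRel ∪
          {x | ∃ (n : ℕ) (r r' : IntegralRep (n + 1)) (Φ : (Fin (n + 1) → ℝ) → (Fin (n + 1) → ℝ))
              (Φ' : (Fin (n + 1) → ℝ) → (Fin (n + 1) → ℝ) →L[ℝ] (Fin (n + 1) → ℝ)),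
            IsSemialgebraicMapOn ℚ r.domain Φ ∧
            (∀ x ∈ r.domain, HasFDerivWithinAt Φ (Φ' x) r.domain x) ∧ Set.InjOn Φ r.domain ∧
            r'.domain = Φ '' r.domain ∧
            (∀ x ∈ r.domain, r.integrand x = r'.integrand (Φ x) * |(Φ' x).det|) ∧
            (∀ x ∈ r.domain,
              (Set.Ioo (a : ℝ) b).indicator (fun t => 1 / (2 * Real.sqrt (1 - t ^ 2))) (Φ x 0) =
              (Set.Ioo (a : ℝ) b).indicator (fun t => 1 / (2 * Real.sqrt (1 - t ^ 2))) (x 0)) ∧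
            x = of r - of r'} ∪
          fibredNewtonLeibnizRel)) := by
  intro a b ha hab hb
  -- the admissible weight (semialgebraic on `ℝ¹`, bounded)
  obtain ⟨hw, C, hC⟩ := stub_stripWeight a b ha hab hb
  -- the finishing weighted disc `[D, w_{a,b}] ∼ b - a`
  obtain ⟨Dw, hDw, hDw1, hDwc⟩ := stub_stripConst a b ha hab hb
  have hκ : IsAlgebraic ℚ ((b - a : ℚ) : ℝ) := by
    have h := isAlgebraic_algebraMap (R := ℚ) (A := ℝ) (b - a : ℚ)
    rwa [eq_ratCast] at h
  have hκ0 : ((b - a : ℚ) : ℝ) ≠ 0 := by exact_mod_cast (sub_pos.2 hab).ne'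
  have hfin : ∀ c : FormalRep, of Dw * c ∈ relations → of piRep * c ∈ relations → c ∈ relations :=
    fun c hc _ => mem_relations_of_of_mul_mem_of_forall_prod_equivalent Dw hκ hκ0 (hDwc hκ) c hc
  exact ayoubPiCancellation_iff_weightReduction
    ((Set.Ioo (a : ℝ) b).indicator (fun t => 1 / (2 * Real.sqrt (1 - t ^ 2)))) hw C hC hDw hDw1 hfin

end Summit.KontsevichZagierPeriods.KontsevichZagierPeriods.AyoubPiCancellationLine
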